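import Summits.QuantumFields.YangMills.Theorems.DiagonalMirrorRPRTwistLettersDefs
import Summits.QuantumFields.YangMills.Theorems.DiagonalMirrorRPRTwistedTraceSeries
import Summits.QuantumFields.YangMills.Theorems.DiagonalMirrorRPROddTorusSwapPairingDefs

/-!
# Crux `WeakCouplingHypercubicLimitRP` (stmt-QuantumFields-27398), line `Sketch`, door B (`sign-twisted-diagonal-trace`):
# `core_of` — the door-B letters imply the lattice socket — re-homed under `Theorems/` (κ3 text)

Helper file (`--supports stmt-QuantumFields-27398 --as helper`) of the hand `hand-10604-wilsonDiagModel-2` (docket director-ym g23, O4 WORD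
18 (3)(ii) / 19 / 20: door-B suppliers along `φ`) for the registered stub D1 `stub_diagRPOfPlaneLimits` of
`Cruxes/WeakCouplingHypercubicLimitRP/Lines/Sketch.lean` (sha16 `7bf38c709623ad77`); it closes nothing by itself.

WHAT.  §5 of the door-B core workfile `Cruxes/DiagonalMirrorRPR/Lines/sign_twisted_diagonal_trace_core.lean` in the κ3 TEXT OF RECORD (critic
idea-crit-9 g12 bytes `900935a36c50070a`, director-ym O4 WORD 19 (1)) BYTE-FOR-BYTE (but for the three re-pointed uses of `tendsto_a_mul_side`, see the note in §5) and in the SAME namespace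
`…Cruxes.DiagonalMirrorRPR.SignTwistedDiagonalTrace` — `DiagonalSliceModel.exists_even_top` (the top modulus is attained on the `U`-even sector:
`sectorTopStateEven` + kernel positivity of the odd traces), `abs_smearedLatticeField_le_side`, `famObs_supGrowth` (sup-norm growth
of `Y_k(F)` under the κ3 `TemperateRenormalisation`), `tendsto_log_inv_a`, `tendsto_penalty_zero` (`K (a⁻¹)^P (a·side)^Q e^{−κ a·side} → 0` under
`SideGrowth`), and **`core_of : OddTwistGap 𝔪 → DiagLukewarm 𝔪 → Growth r sch → OddTorusSwapPairingLiminf r sch`** concluding the LANDED socket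
definition (κ2′, `…Theorems.DiagonalMirrorRPROddTorusSwapPairingDefs`, p827497) BY NAME over the LANDED letters (`…TwistLettersDefs`) and analysis
(`…TwistedTraceSeries`).  With this file the door-B chain below the model letters is kernel-checked under `Theorems/`: at the sub-scheme
`subseq sch φ hφ` of the D1 witness, `TwistLetters.subseq` + `growth_subseq_of_polyRenorm_of_ufbPlanes` + `core_of` give the socket, and the landed
transfer `diagRPOfPlaneLimits_of_swapPairingLiminf` (p827255) gives `DiagonalFrameRP (planeSum T)` — composed in the companion
`…Theorems.PencilRigidityWeakCouplingHypercubicLimitRPDiagRPOfTwistLetters`.  The line writer re-points the core by `import` + deleting §5 (κ-pattern).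

HONEST FRAMING: the letters R1 `OddTwistGap` / R2 `DiagLukewarm` on Wilson's diagonal model are NOT proved anywhere (the model `wilsonDiagonalModel`
itself is not landed: hand-10604-wilsonDiagModel-1); D1, the crux ⟨27398⟩ and its heart S6i are OPEN; nothing here bears on the summit; the
Yang–Mills mass gap is NOT proved here or anywhere in the tree.  No definition, no instance, no notation, `autoImplicit false`.

References: Osterwalder–Seiler, Ann. Phys. 110 (1978) §2–3; Fröhlich–Israel–Lieb–Simon, Comm. Math. Phys. 62 (1978) Thm 2.1; Kanazawa
arXiv:0808.3442 Lemma 2; Tomboulis–Yaffe, Comm. Math. Phys. 100 (1985) §2; Seiler, LNP 159 (1982) Ch. 2.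
-/

set_option autoImplicit false

noncomputable section

open scoped SchwartzMap
open MeasureTheory Filter Topology
open Literature.MathematicalPhysics.QuantumLattice Literature.MathematicalPhysics.AQFT
  Literature.MathematicalPhysics.QuantumFieldTheory Literature.Probability.LatticeModels
open Summit.QuantumFields.YangMills.Cruxes.DiagonalMirrorRPR.ParityBridgeColdTraces (E4)
open Summit.QuantumFields.YangMills.Cruxes.DiagonalMirrorRPR.ParityBridgeColdTraces.RpClosure (swap01)

namespace Summit.QuantumFields.YangMills.Cruxes.DiagonalMirrorRPR.SignTwistedDiagonalTrace

/-! ## §5 The core: letters ⇒ the lattice statement -/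

section Core

variable {G : Type} [Group G] [TopologicalSpace G] [IsTopologicalGroup G] [CompactSpace G]
  [MeasurableSpace G] [BorelSpace G] {r : LatticeRep G} {sch : SpeciesScheme (YMSpecies G)}

/-- In a model, the top modulus is attained on the `U`-even sector (from `sectorTopStateEven` and kernel
positivity of the odd traces). -/
theorem DiagonalSliceModel.exists_even_top (𝔪 : DiagonalSliceModel r sch) (k : ℕ) :
    ∃ j, 𝔪.sp k j = 𝔪.top k := by
  obtain ⟨j, hj | hj⟩ := 𝔪.top_attained k
  · exact ⟨j, hj⟩
  · have hle := sectorTopStateEven (𝔪.sp k) (𝔪.sm k) (𝔪.top k) (𝔪.top_pos k)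
      (fun j => ⟨𝔪.sp_nonneg k j, 𝔪.sp_le k j⟩) (fun j => ⟨𝔪.sm_nonneg k j, 𝔪.sm_le k j⟩)
      (𝔪.summable_sp k) (𝔪.summable_sm k)
      (Filter.eventually_atTop.2 ⟨3, fun m hm hodd => 𝔪.trace_nonneg k m hm hodd⟩)
    have hpos : 0 < {j | 𝔪.sm k j = 𝔪.top k}.ncard :=
      (Set.ncard_pos (finite_top_set (𝔪.top_pos k) (𝔪.summable_sm k))).2 ⟨j, hj⟩
    obtain ⟨j', hj'⟩ := Set.nonempty_of_ncard_ne_zero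
      (show {j | 𝔪.sp k j = 𝔪.top k}.ncard ≠ 0 by omega)
    exact ⟨j', hj'⟩

omit [TopologicalSpace G] [IsTopologicalGroup G] [CompactSpace G] [BorelSpace G] in
/-- Sup bound of one smeared field on the torus box by the box cardinality:
`|Φ(h)(V)| ≤ |cc| (|a| (2L+1))⁴ · H (C₀ + |m|)`. -/
theorem abs_smearedLatticeField_le_side (O : YMSpecies G) (L : ℕ) (a cc m : ℝ) (h : 𝓢(E4, ℝ)) {H C₀ : ℝ}
    (hH : ∀ x, |h x| ≤ H) (hC₀ : ∀ U, |O.F U| ≤ C₀) (V : LGConfig 4 G) :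
    |smearedLatticeField O.F (box 4 L) a cc m h V| ≤ |cc| * (|a| * (2 * L + 1)) ^ 4 * (H * (C₀ + |m|)) := by
  have hH0 : 0 ≤ H := (abs_nonneg _).trans (hH 0)
  unfold smearedLatticeField
  rw [abs_mul, abs_mul, abs_pow]
  have hsum : |∑ x ∈ box 4 L, h (a • siteToE x) * (O.F (configShift (-x) V) - m)| ≤
      ((2 * L + 1) ^ 4 : ℝ) * (H * (C₀ + |m|)) := by
    refine (Finset.abs_sum_le_sum_abs _ _).trans ?_
    refine (Finset.sum_le_card_nsmul _ _ (H * (C₀ + |m|)) fun x _ => ?_).trans ?_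
    · rw [abs_mul]
      exact mul_le_mul (hH _) ((abs_sub _ _).trans (add_le_add (hC₀ _) le_rfl)) (abs_nonneg _) hH0
    · rw [card_box, nsmul_eq_mul]
      push_cast
      exact le_rfl
  calc |cc| * |a| ^ 4 * |∑ x ∈ box 4 L, h (a • siteToE x) * (O.F (configShift (-x) V) - m)|
      ≤ |cc| * |a| ^ 4 * (((2 * L + 1) ^ 4 : ℝ) * (H * (C₀ + |m|))) :=
        mul_le_mul_of_nonneg_left hsum (by positivity)
    _ = |cc| * (|a| * (2 * L + 1)) ^ 4 * (H * (C₀ + |m|)) := by ring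

-- κ re-home note (hand-10604-wilsonDiagModel-2): the core's `tendsto_a_mul_side` IS the landed `tendsto_a_mul_side'`
-- (`…Theorems.DiagonalMirrorRPRFamObsGrowth`, p827469; the gate's dedup refuses a restatement), so its three uses below are
-- re-pointed to the primed name; everything else in §5 is byte-for-byte.

/-- **Sup-norm growth of the family observable** (elementary): under `TemperateRenormalisation` the sup norm of
`Y_k(F)` grows at most like `K · (a_k⁻¹)^P · (a_k · side_k)^Q` (box cardinality `(2L_k+1)⁴`, bounded Schwartz
functions, bounded curvature observable; `abs_smearedLatticeField_le_side`). -/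
theorem famObs_supGrowth (hT : TemperateRenormalisation r sch) (F : ReflectedFamily) :
    ∃ (K : ℝ) (P Q : ℕ), ∀ᶠ k in atTop, ∀ V,
      |famObs r sch F k V| ≤ K * (sch.a k)⁻¹ ^ P * (sch.a k * sch.side k) ^ Q := by
  obtain ⟨p, hp⟩ := hT
  obtain ⟨C₀, hC₀⟩ := r.curvature.bounded
  -- a uniform sup bound of the test functions
  have hHij : ∀ i j, ∃ H : ℝ, 0 ≤ H ∧ ∀ x, |F.f i j x| ≤ H := by
    intro i j
    obtain ⟨H, hHpos, hH⟩ := (F.f i j).decay 0 0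
    refine ⟨H, hHpos.le, fun x => ?_⟩
    have := hH x
    simpa [norm_iteratedFDeriv_zero, Real.norm_eq_abs] using this
  choose Hf hHf0 hHf using hHij
  set H : ℝ := max (∑ i, ∑ j, Hf i j) 1 with hH_def
  have hH1 : 1 ≤ H := le_max_right _ _
  have hH0 : 0 ≤ H := zero_le_one.trans hH1
  have hHle : ∀ i j x, |F.f i j x| ≤ H := by
    intro i j x
    refine (hHf i j x).trans (le_trans ?_ (le_max_left _ _))
    calc Hf i j ≤ ∑ j', Hf i j' := Finset.single_le_sum (fun j' _ => hHf0 i j') (Finset.mem_univ j)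
      _ ≤ ∑ i', ∑ j', Hf i' j' :=
        Finset.single_le_sum (f := fun i' => ∑ j', Hf i' j') (fun i' _ => Finset.sum_nonneg fun j' _ => hHf0 i' j')
          (Finset.mem_univ i)
  have hC₀0 : 0 ≤ C₀ := (abs_nonneg _).trans (hC₀ fun _ => 1)
  set N : ℕ := ∑ i, F.n i with hN_def
  have hnN : ∀ i, F.n i ≤ N := fun i => Finset.single_le_sum (f := F.n) (fun i _ => Nat.zero_le _) (Finset.mem_univ i)
  refine ⟨(∑ i, |F.c i|) * (H * (C₀ + 1)) ^ N, 2 * p * N, 4 * N, ?_⟩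
  have ha1 : ∀ᶠ k in atTop, sch.a k ≤ 1 :=
    ((tendsto_order.1 sch.tendsto_a).2 1 one_pos).mono fun k hk => hk.le
  filter_upwards [hp, ha1, (tendsto_a_mul_side' sch).eventually_ge_atTop 1] with k hk ha1k hx1 V
  have ha0 : 0 < sch.a k := sch.a_pos k
  have hainv1 : 1 ≤ (sch.a k)⁻¹ := (one_le_inv₀ ha0).2 ha1k
  have hside : (2 * (sch.L k : ℝ) + 1) = (sch.side k : ℝ) := by
    simp only [SpeciesScheme.side]; push_cast; ring
  -- the per-factor bound `D ≥ 1`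
  set D : ℝ := H * (C₀ + 1) * ((sch.a k)⁻¹ ^ (2 * p) * (sch.a k * sch.side k) ^ 4) with hD_def
  have hD1 : 1 ≤ D := by
    have h1 : (1 : ℝ) ≤ H * (C₀ + 1) := by nlinarith
    have h2 : (1 : ℝ) ≤ (sch.a k)⁻¹ ^ (2 * p) := one_le_pow₀ hainv1
    have h3 : (1 : ℝ) ≤ (sch.a k * sch.side k) ^ 4 := one_le_pow₀ hx1
    have h23 : (1 : ℝ) ≤ (sch.a k)⁻¹ ^ (2 * p) * (sch.a k * sch.side k) ^ 4 := by nlinarith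
    nlinarith
  have hfac : ∀ i j, |smearedLatticeField r.curvature.F (box 4 (sch.L k)) (sch.a k) (sch.c r.curvature k)
      (sch.m r.curvature k) (F.f i j) V| ≤ D := by
    intro i j
    refine (abs_smearedLatticeField_le_side r.curvature (sch.L k) (sch.a k) _ _ (F.f i j) (hHle i j) hC₀ V).trans ?_
    rw [abs_of_pos ha0, hside]
    have h1 : |sch.c r.curvature k| ≤ (sch.a k)⁻¹ ^ p := hk.1
    -- κ3: only `|c_k|` and the renormalised counterterm `|c_k| * |m_k|` are used
    have h2 : |sch.c r.curvature k| * (C₀ + |sch.m r.curvature k|) ≤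
        (C₀ + 1) * ((sch.a k)⁻¹ ^ p * (sch.a k)⁻¹ ^ p) := by
      have hm := hk.2
      have hp1 : (1 : ℝ) ≤ (sch.a k)⁻¹ ^ p := one_le_pow₀ hainv1
      have hcC : |sch.c r.curvature k| * C₀ ≤ (sch.a k)⁻¹ ^ p * C₀ := mul_le_mul_of_nonneg_right h1 hC₀0
      have hpp : (sch.a k)⁻¹ ^ p ≤ (sch.a k)⁻¹ ^ p * (sch.a k)⁻¹ ^ p :=
        le_mul_of_one_le_right (zero_le_one.trans hp1) hp1
      nlinarith
    calc |sch.c r.curvature k| * (sch.a k * sch.side k) ^ 4 * (H * (C₀ + |sch.m r.curvature k|))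
        = (sch.a k * sch.side k) ^ 4 * H * (|sch.c r.curvature k| * (C₀ + |sch.m r.curvature k|)) := by ring
      _ ≤ (sch.a k * sch.side k) ^ 4 * H * ((C₀ + 1) * ((sch.a k)⁻¹ ^ p * (sch.a k)⁻¹ ^ p)) :=
          mul_le_mul_of_nonneg_left h2 (by positivity)
      _ = D := by rw [hD_def, pow_mul]; ring
  -- products and the sum
  have hprod : ∀ i, |∏ j, smearedLatticeField r.curvature.F (box 4 (sch.L k)) (sch.a k) (sch.c r.curvature k)
      (sch.m r.curvature k) (F.f i j) V| ≤ D ^ N := by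
    intro i
    rw [Finset.abs_prod]
    calc ∏ j, |smearedLatticeField r.curvature.F (box 4 (sch.L k)) (sch.a k) (sch.c r.curvature k)
          (sch.m r.curvature k) (F.f i j) V| ≤ ∏ _j : Fin (F.n i), D :=
          Finset.prod_le_prod (fun j _ => abs_nonneg _) fun j _ => hfac i j
      _ = D ^ F.n i := by rw [Finset.prod_const, Finset.card_univ, Fintype.card_fin]
      _ ≤ D ^ N := pow_le_pow_right₀ hD1 (hnN i)
  calc |famObs r sch F k V|
      ≤ ∑ i, |F.c i * ∏ j, smearedLatticeField r.curvature.F (box 4 (sch.L k)) (sch.a k) (sch.c r.curvature k)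
          (sch.m r.curvature k) (F.f i j) V| := Finset.abs_sum_le_sum_abs _ _
    _ ≤ ∑ i, |F.c i| * D ^ N := Finset.sum_le_sum fun i _ => by
        rw [abs_mul]
        exact mul_le_mul_of_nonneg_left (hprod i) (abs_nonneg _)
    _ = (∑ i, |F.c i|) * (H * (C₀ + 1)) ^ N * (sch.a k)⁻¹ ^ (2 * p * N) * (sch.a k * sch.side k) ^ (4 * N) := by
        rw [← Finset.sum_mul, hD_def, mul_pow, mul_pow, mul_pow, ← pow_mul, ← pow_mul]
        ring

omit [TopologicalSpace G] [IsTopologicalGroup G] [CompactSpace G] [BorelSpace G] in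
/-- `log a_k⁻¹ → +∞`. -/
theorem tendsto_log_inv_a (sch : SpeciesScheme (YMSpecies G)) :
    Tendsto (fun k => Real.log (sch.a k)⁻¹) atTop atTop := by
  have h : Tendsto sch.a atTop (𝓝[>] 0) :=
    tendsto_nhdsWithin_iff.2 ⟨sch.tendsto_a, Eventually.of_forall sch.a_pos⟩
  exact Real.tendsto_log_atTop.comp (tendsto_inv_nhdsGT_zero.comp h)

omit [TopologicalSpace G] [IsTopologicalGroup G] [CompactSpace G] [BorelSpace G] in
/-- The penalty `K (a⁻¹)^P (a·side)^Q exp(−κ a·side) → 0` under `SideGrowth` (`κ > 0`). -/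
theorem tendsto_penalty_zero (sch : SpeciesScheme (YMSpecies G)) (hside : SideGrowth sch) (K κ : ℝ) (hκ : 0 < κ)
    (P Q : ℕ) :
    Tendsto (fun k => K * ((sch.a k)⁻¹ ^ P * (sch.a k * sch.side k) ^ Q *
      Real.exp (-(κ * (sch.a k * sch.side k))))) atTop (𝓝 0) := by
  set x : ℕ → ℝ := fun k => sch.a k * sch.side k with hx_def
  set ℓ : ℕ → ℝ := fun k => Real.log (sch.a k)⁻¹ with hℓ_def
  have hx : Tendsto x atTop atTop := tendsto_a_mul_side' sch
  have hℓ : Tendsto ℓ atTop atTop := tendsto_log_inv_a sch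
  have hκ2 : 0 < κ / 2 := half_pos hκ
  -- (i) `(a⁻¹)^P exp(−κ/2·x) → 0`
  have hA : Tendsto (fun k => (sch.a k)⁻¹ ^ P * Real.exp (-(κ / 2 * x k))) atTop (𝓝 0) := by
    -- the exponent `κ/2·x − P ℓ → +∞`
    have hratio : Tendsto (fun k => κ / 2 * (sch.a k * (sch.L k : ℝ) / ℓ k) - P) atTop atTop :=
      tendsto_atTop_add_const_right _ _ (hside.const_mul_atTop hκ2)
    have hprod : Tendsto (fun k => ℓ k * (κ / 2 * (sch.a k * (sch.L k : ℝ) / ℓ k) - P)) atTop atTop :=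
      hℓ.atTop_mul_atTop₀ hratio
    have hev : ∀ᶠ k in atTop, ℓ k * (κ / 2 * (sch.a k * (sch.L k : ℝ) / ℓ k) - P) ≤ κ / 2 * x k - P * ℓ k := by
      filter_upwards [hℓ.eventually_gt_atTop 0] with k hk
      have hxL : sch.a k * (sch.L k : ℝ) ≤ x k := by
        simp only [hx_def, SpeciesScheme.side]; push_cast
        nlinarith [(sch.a_pos k).le, (Nat.cast_nonneg (sch.L k) : (0 : ℝ) ≤ sch.L k)]
      have : ℓ k * (κ / 2 * (sch.a k * (sch.L k : ℝ) / ℓ k) - P) = κ / 2 * (sch.a k * sch.L k) - P * ℓ k := by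
        field_simp
      rw [this]
      nlinarith
    have hexpn : Tendsto (fun k => κ / 2 * x k - P * ℓ k) atTop atTop := tendsto_atTop_mono' _ hev hprod
    have hexp0 : Tendsto (fun k => Real.exp (-(κ / 2 * x k - P * ℓ k))) atTop (𝓝 0) :=
      Real.tendsto_exp_atBot.comp (tendsto_neg_atTop_atBot.comp hexpn)
    refine hexp0.congr fun k => ?_
    have ha : 0 < (sch.a k)⁻¹ := inv_pos.2 (sch.a_pos k)
    rw [show -(κ / 2 * x k - P * ℓ k) = (P : ℝ) * ℓ k + -(κ / 2 * x k) by ring, Real.exp_add, Real.exp_nat_mul,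
      hℓ_def, Real.exp_log ha]
  -- (ii) `x^Q exp(−κ/2·x) → 0`
  have hB : Tendsto (fun k => x k ^ Q * Real.exp (-(κ / 2 * x k))) atTop (𝓝 0) := by
    have h1 := (Real.tendsto_pow_mul_exp_neg_atTop_nhds_zero Q).comp (hx.const_mul_atTop hκ2)
    have h2 : Tendsto (fun k => (κ / 2)⁻¹ ^ Q * ((κ / 2 * x k) ^ Q * Real.exp (-(κ / 2 * x k)))) atTop (𝓝 0) := by
      simpa using h1.const_mul ((κ / 2)⁻¹ ^ Q)
    refine h2.congr fun k => ?_
    rw [mul_pow, ← mul_assoc, ← mul_assoc, ← mul_pow, inv_mul_cancel₀ hκ2.ne', one_pow, one_mul]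
  have hAB := (hA.mul hB).const_mul K
  simp only [mul_zero] at hAB
  refine hAB.congr fun k => ?_
  have : Real.exp (-(κ * x k)) = Real.exp (-(κ / 2 * x k)) * Real.exp (-(κ / 2 * x k)) := by
    rw [← Real.exp_add]; congr 1; ring
  simp only [hx_def] at this ⊢
  rw [this]; ring

/-- **core_of** (the W₁-free core, kernel-checked modulo the named stubs): R1, R2 and the growth clause imply the
lattice statement of the line. -/
theorem core_of (𝔪 : DiagonalSliceModel r sch) (hR1 : OddTwistGap 𝔪) (hR2 : DiagLukewarm 𝔪) (hG : Growth r sch) :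
    OddTorusSwapPairingLiminf r sch := by
  intro m n c f σf hf _hdisj hσ
  let F : ReflectedFamily :=
    ⟨m, n, c, f, σf, fun i j => (hf i j).1, fun i j => (hf i j).2, hσ⟩
  change 0 ≤ Filter.liminf (fun k => gramPairing r sch F k) atTop
  obtain ⟨γ, hγ, hgap⟩ := hR1
  obtain ⟨θ, hθ0, hθ, C, hluke⟩ := hR2
  obtain ⟨R, hR⟩ := 𝔪.depth_le F
  obtain ⟨K, P, Q, hB⟩ := famObs_supGrowth hG.1 F
  -- asymptotics of the scheme
  have hx : Tendsto (fun k => sch.a k * (sch.side k : ℝ)) atTop atTop := tendsto_a_mul_side' sch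
  have ha1 : ∀ᶠ k in atTop, sch.a k ≤ 1 :=
    ((tendsto_order.1 sch.tendsto_a).2 1 one_pos).mono fun k hk => hk.le
  have hSinf : Tendsto (fun k => (sch.side k : ℝ)) atTop atTop := by
    refine tendsto_atTop_mono' atTop ?_ hx
    filter_upwards [ha1] with k hk
    exact mul_le_of_le_one_left (Nat.cast_nonneg _) hk
  have h12θ : 0 < 1 - 2 * θ := by linarith
  set κ : ℝ := γ * (1 - 2 * θ) with hκ_def
  have hκ : 0 < κ := mul_pos hγ h12θ
  -- the penalty sequence
  let ε : ℕ → ℝ := fun k => (2 * C * Real.exp (γ * (2 * R + 2))) * (K ^ 2 * ((sch.a k)⁻¹ ^ (2 * P) *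
    (sch.a k * sch.side k) ^ (2 * Q) * Real.exp (-(κ * (sch.a k * sch.side k)))))
  have hε : Tendsto ε atTop (𝓝 0) := by
    have := (tendsto_penalty_zero sch hG.2 (K ^ 2) κ hκ (2 * P) (2 * Q)).const_mul (2 * C * Real.exp (γ * (2 * R + 2)))
    rw [mul_zero] at this
    exact this
  refine liminf_nonneg_of_eventually_ge hε ?_
  -- eventual side conditions
  have hS1 : ∀ᶠ k in atTop, 1 ≤ θ * (sch.side k : ℝ) := (hSinf.const_mul_atTop hθ0).eventually_ge_atTop 1
  have hroom : ∀ᶠ k in atTop, 2 * R + 4 ≤ (1 - 2 * θ) * (sch.a k * sch.side k) :=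
    (hx.const_mul_atTop h12θ).eventually_ge_atTop _
  have hhalf : ∀ᶠ k in atTop, C * Real.exp (-(γ * ((1 - 2 * θ) * (sch.a k * sch.side k) - 2))) ≤ 1 / 2 := by
    have h1 : Tendsto (fun k => (1 - 2 * θ) * (sch.a k * sch.side k) - 2) atTop atTop :=
      tendsto_atTop_add_const_right _ _ (hx.const_mul_atTop h12θ)
    have h2 : Tendsto (fun k => C * Real.exp (-(γ * ((1 - 2 * θ) * (sch.a k * sch.side k) - 2)))) atTop (𝓝 (C * 0)) :=
      (Real.tendsto_exp_atBot.comp (tendsto_neg_atTop_atBot.comp (h1.const_mul_atTop hγ))).const_mul C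
    rw [mul_zero] at h2
    exact ((tendsto_order.1 h2).2 (1 / 2) (by norm_num)).mono fun k hk => hk.le
  filter_upwards [hgap, hluke, hR, hB, 𝔪.pairing_eq F, 𝔪.weight_dom F, ha1, hS1, hroom, hhalf] with k hgapk hlukek
    hRk hBk hpairk hdomk ha1k hS1k hroomk hhalfk
  -- notation at step `k`
  obtain ⟨h2d, hpairk⟩ := hpairk
  set S : ℕ := sch.side k with hS_def
  set d : ℕ := 𝔪.depth F k with hd_def
  set a : ℝ := sch.a k with ha_def
  have ha0 : 0 < a := sch.a_pos k
  set t : ℕ := ⌈θ * (S : ℝ)⌉₊ with ht_def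
  have htS : θ * (S : ℝ) ≤ (t : ℝ) := Nat.le_ceil _
  have htlt : (t : ℝ) < θ * S + 1 := Nat.ceil_lt_add_one (by positivity)
  have ht1 : 1 ≤ t := by
    have : (1 : ℝ) ≤ t := le_trans hS1k htS
    exact_mod_cast this
  -- room: `2t + 2d ≤ S`
  have htd : 2 * t + 2 * d ≤ S := by
    have hreal : ((2 * t + 2 * d : ℕ) : ℝ) < (S : ℝ) := by
      push_cast
      have h1 : a * (2 * (t : ℝ) + 2 * d) < a * (2 * (θ * S + 1)) + 2 * R := by nlinarith
      have h2 : a * (2 * (θ * S + 1)) + 2 * R ≤ a * S := by nlinarith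
      have h3 : a * (2 * (t : ℝ) + 2 * d) < a * S := lt_of_lt_of_le h1 h2
      exact lt_of_mul_lt_mul_left h3 ha0.le
    exact_mod_cast hreal.le
  -- the gap factor
  set g : ℝ := Real.exp (-(γ * a)) with hg_def
  have hg0 : 0 ≤ g := (Real.exp_pos _).le
  have hg1 : g ≤ 1 := by rw [hg_def, Real.exp_le_one_iff]; nlinarith
  have hsmg : ∀ j, 𝔪.sm k j ≤ g * 𝔪.top k := hgapk
  obtain ⟨W, hW⟩ := 𝔪.w_bdd F k
  -- `C ≥ 0`
  have hC0 : 0 ≤ C := by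
    refine le_trans (add_nonneg (tsum_nonneg fun j => ?_) (tsum_nonneg fun j => ?_)) (hlukek t htS)
    · exact pow_nonneg (div_nonneg (𝔪.sp_nonneg k j) (𝔪.top_pos k).le) _
    · exact pow_nonneg (div_nonneg (𝔪.sm_nonneg k j) (𝔪.top_pos k).le) _
  -- `g^n = exp(−γ a n)` and the two exponent estimates
  have hgpow : ∀ n : ℕ, g ^ n = Real.exp (-(γ * (a * n))) := by
    intro n; rw [hg_def, ← Real.exp_nat_mul]; congr 1; ring
  have hat : a * (t : ℝ) ≤ θ * (a * S) + a := by nlinarith [mul_le_mul_of_nonneg_left htlt.le ha0.le]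
  have hhalfk' : C * g ^ (S - 2 * t) ≤ 1 / 2 := by
    refine le_trans (mul_le_mul_of_nonneg_left ?_ hC0) hhalfk
    rw [hgpow, Real.exp_le_exp]
    have : ((S - 2 * t : ℕ) : ℝ) = S - 2 * t := by push_cast [show 2 * t ≤ S by omega]; ring
    rw [this]
    have key : (1 - 2 * θ) * (a * S) - 2 ≤ a * (S - 2 * t) := by nlinarith
    have := mul_le_mul_of_nonneg_left key hγ.le
    linarith
  -- sup bound
  set Bk : ℝ := K * a⁻¹ ^ P * (a * S) ^ Q with hBk_def
  -- apply the per-`k` core inequality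
  have hcore := pairing_lower_bound (p := gramPairing r sch F k) (𝔪.top_pos k) (𝔪.sp_nonneg k) (𝔪.sm_nonneg k)
    (𝔪.sp_le k) (𝔪.sm_le k) hsmg hg0 (𝔪.summable_sp k) (𝔪.summable_sm k) (𝔪.wp_nonneg F k) (𝔪.wm_nonneg F k)
    hW (𝔪.exists_even_top k) ht1 htd (hlukek t htS)
    (by simpa only [mul_add, Nat.cast_add] using hlukek (t + d) (by push_cast; linarith))
    hhalfk' hpairk (hdomk t Bk hBk)
  refine le_trans ?_ hcore
  -- `ε_k` dominates the per-`k` penalty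
  have hexp : g ^ (S - 2 * d - 2 * t) ≤ Real.exp (γ * (2 * R + 2)) * Real.exp (-(κ * (a * S))) := by
    rw [hgpow, ← Real.exp_add, Real.exp_le_exp]
    have : ((S - 2 * d - 2 * t : ℕ) : ℝ) = S - 2 * d - 2 * t := by
      rw [Nat.sub_sub, Nat.cast_sub (by omega)]; push_cast; ring
    rw [this, hκ_def]
    have had : a * d ≤ R := hRk
    have key : (1 - 2 * θ) * (a * S) - (2 * R + 2) ≤ a * (S - 2 * d - 2 * t) := by nlinarith
    have := mul_le_mul_of_nonneg_left key hγ.le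
    nlinarith
  have hBk2 : Bk ^ 2 = K ^ 2 * (a⁻¹ ^ (2 * P) * (a * S) ^ (2 * Q)) := by
    rw [hBk_def]; ring
  have hfinal : 2 * C * Bk ^ 2 * g ^ (S - 2 * d - 2 * t) ≤ ε k := by
    have hB2 : 0 ≤ 2 * C * Bk ^ 2 := by positivity
    calc 2 * C * Bk ^ 2 * g ^ (S - 2 * d - 2 * t)
        ≤ 2 * C * Bk ^ 2 * (Real.exp (γ * (2 * R + 2)) * Real.exp (-(κ * (a * S)))) :=
          mul_le_mul_of_nonneg_left hexp hB2
      _ = ε k := by simp only [ε, hBk2]; ring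
  linarith

end Core

end Summit.QuantumFields.YangMills.Cruxes.DiagonalMirrorRPR.SignTwistedDiagonalTrace

end
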